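import Literature.Probability.LatticeModels.DobrushinComparisonDefectStates
import HarnessLib

/-!
# Robust ball (Y2) — Föllmer's PAIRWISE covariance estimate in the Kantorovich–Rubinstein form,
# `|cov_μ(f,g)| ≤ R² Σ_{x ∈ Δ_f} Σ_{y ∈ Δ_g} δ_x(f) u(x,y) δ_y(g)` for any family of COLUMN SUPERSOLUTIONS `u(·,y) ≥ D(·,y)`

HONEST FRAMING: venture file of the cell `pub-ymgap` (QuantumFields programme), track ROBUST-BALL, seat rb-p2 (g10).  Generic
Dobrushin-regime bookkeeping for an arbitrary specification `γ` under Dobrushin's condition in the Vasserstein form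
(`IsKRContraction γ r nbr C`, weight `0 ≤ r ≤ R`, rows `≤ c < 1`); no lattice, no gauge group, no number; nothing continuum / Clay.
WHAT IT DOES.  The tree's covariance estimates (`DobrushinMetric.abs_covariance_le_of_isKRContraction`, this seat's
`DobrushinSupersolution.abs_covariance_le_of_supersolution`) bound `cov_μ(f,g)` through the HITTING vector of the whole dependence
SET `Δ_g` — one profile serves every site of `Δ_g`, which is why only axis-separated or translate shapes were reachable at the sharp
axial rate.  Föllmer's Theorem (2.13) (Künsch 1982) is PAIRWISE: `|cov_μ(f,g)| ≤ Σ_{x,y} δ_x(f) D_{xy} b_y(g)`, `D = Σₙ Cⁿ`.  We derive it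
from the tree's Comparison Theorem (2.8) WITH DEFECTS (`DustingData.abs_sub_le_sum_of_superSolution`): the tilt `ν = g̃μ/μ(g̃)`
(`g̃ = g − inf g ≥ 0`) is a state whose defect at `x` against the one-site kernel `γ_x` is `|ν(γ_x f) − ν(f)| ≤ R² δ_x(g) δ_x(f)/μ(g̃)`
(`abs_integral_mul_siteAvg_sub_le`: `μ(g̃ γ_x f) − μ(g̃ f) = μ((g̃ − γ_x g̃)(γ_x f − f))` by the DLR equation at `x`, and both factors
are one-site oscillations `≤ δ·R`), so every `d ≥ 0` with `R² δ_g(x) 1_{Δ_g}(x) + (C d)(x) ≤ d(x)·` dominates `μ(g̃)|ν(f) − μ(f)| = |cov|`: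
* `abs_covariance_le_pairwise` — for ANY family `u(·,y) ≥ 0`, `y ∈ Δ_g`, of column supersolutions `1_{x = y} + Σ_z C(x,z) u(z,y) ≤ u(x,y)`
  (all `x`): `|cov_μ(f,g)| ≤ R² Σ_{x ∈ Δ_f} Σ_{y ∈ Δ_g} δ_f(x) u(x,y) δ_g(y)`;
* `abs_covariance_le_pairwise_of_strict` — the Lyapunov form: `p(·,y) ≥ 0`, `p(y,y) > 0`, `Σ_z C(x,z) p(z,y) ≤ s·p(x,y)` with `s < 1`
  give `u = p/((1−s) p(y,y))`, whence `|cov| ≤ (R²/(1−s)) Σ Σ δ_f(x) (p(x,y)/p(y,y)) δ_g(y)`;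
* `abs_covariance_le_of_pair_profile` — if moreover `p(x,y)/p(y,y) ≤ B·t` on `Δ_f × Δ_g` then
  `|cov_μ(f,g)| ≤ (R² B/(1−s)) (Σ δ_g)(Σ δ_f) · t` — the currency shape `A (Σδ_g)(Σδ_f) e^{−m n}` of the programme, reached with a
  DIFFERENT profile for every pair `(x, y)` (e.g. the axis through `y` along which `x` is farthest).

## References
* H. Föllmer, *Random fields and diffusion processes*, LNM 1362 (1988), Ch. I, Comparison Theorem (2.8), (2.10), Theorem (2.13), Remark (2.17).
* H. Künsch, *Decay of correlations under Dobrushin's uniqueness condition and its applications*, Comm. Math. Phys. 84 (1982) 207–222, Thm. 2.1.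
* The tree: `DobrushinComparisonDefect(States).lean` (the defect comparison), `DobrushinMetricStates.lean` (`siteAvg`, tilts, covariance).
-/

noncomputable section

open MeasureTheory ProbabilityTheory Finset Function
open Literature.Probability.LatticeModels Literature.Probability.LatticeModels.DobrushinMetric

namespace Summit.Ventures.YMGap.RobustBall.DobrushinPairwise

variable {V S : Type*} [MeasurableSpace S] {γ : Specification V S} {r : S → S → ℝ} {nbr : V → Finset V}
  {C : V → V → ℝ}

/-! ### One-site averaging: blindness to the resampled spin, one-site oscillation, the DLR product rule -/

/-- Under finite range, `γ_x f (σ)` does not depend on the spin `σ_x`. [cite: Follmer1988, Ch. I (2.20)] -/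
theorem siteAvg_congr_of_eq_off [DecidableEq V] (hγ : IsSpecification γ) (hC : IsKRContraction γ r nbr C) (x : V)
    {f : (V → S) → ℝ} (hf : Measurable f) {σ η : V → S} (h : ∀ z, z ≠ x → σ z = η z) :
    siteAvg γ x f σ = siteAvg γ x f η := by
  rw [siteAvg_eq_integral_siteLaw hγ x hf, siteAvg_eq_integral_siteLaw hγ x hf, hC.siteLaw_congr_of_eq_off x h]
  refine integral_congr_ae (ae_of_all _ fun s => ?_)
  have hupd : update σ x s = update η x s := by
    funext z
    by_cases hz : z = x
    · subst hz; simp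
    · rw [update_of_ne hz, update_of_ne hz, h z hz]
  simp only [hupd]

/-- **One-site oscillation**: `|f(η) − γ_x f(η)| ≤ δ_x(f) · R`. [cite: Follmer1988, Ch. I (2.22)] -/
theorem abs_sub_siteAvg_le [DecidableEq V] (hγ : IsSpecification γ) {R : ℝ} (hrR : ∀ a b, r a b ≤ R) (x : V)
    {f : (V → S) → ℝ} (hf : Measurable f) {M : ℝ} (hM : ∀ σ, |f σ| ≤ M) {δ : V → ℝ} (hδ : IsLipBound r f δ)
    (η : V → S) : |f η - siteAvg γ x f η| ≤ δ x * R := by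
  haveI := isProbabilityMeasure_siteLaw hγ x η
  rw [siteAvg_eq_integral_siteLaw hγ x hf]
  have hint : Integrable (fun s => f (update η x s)) (siteLaw γ x η) :=
    Integrable.of_bound (hf.comp (measurable_update η)).aestronglyMeasurable M
      (ae_of_all _ fun s => by rw [Real.norm_eq_abs]; exact hM _)
  have h1 : f η - ∫ s, f (update η x s) ∂(siteLaw γ x η) = ∫ s, (f η - f (update η x s)) ∂(siteLaw γ x η) := by
    have hc : ∫ _ : S, f η ∂(siteLaw γ x η) = f η := by simp
    rw [integral_sub (integrable_const _) hint, hc]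
  rw [h1]
  have h2 := norm_integral_le_of_norm_le_const (μ := siteLaw γ x η) (f := fun s => f η - f (update η x s))
    (C := δ x * R) (ae_of_all _ fun s => by
      rw [Real.norm_eq_abs]
      calc |f η - f (update η x s)| ≤ δ x * r (η x) (update η x s x) :=
            hδ.le x η (update η x s) fun z hz => by rw [update_of_ne hz]
        _ ≤ δ x * R := mul_le_mul_of_nonneg_left (hrR _ _) (hδ.nonneg x))
  simpa using h2

/-- **Product rule**: `γ_x (γ_x g · f) = γ_x g · γ_x f` (properness and blindness of `γ_x g` to the spin at `x`). [cite: Follmer1988, Ch. I (2.1)] -/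
theorem siteAvg_siteAvg_mul [DecidableEq V] (hγ : IsSpecification γ) (hC : IsKRContraction γ r nbr C) (x : V)
    {g : (V → S) → ℝ} (hgm : Measurable g) (f : (V → S) → ℝ) (η : V → S) :
    siteAvg γ x (fun σ => siteAvg γ x g σ * f σ) η = siteAvg γ x g η * siteAvg γ x f η := by
  show ∫ σ, siteAvg γ x g σ * f σ ∂(γ {x} η) = siteAvg γ x g η * ∫ σ, f σ ∂(γ {x} η)
  rw [← integral_const_mul]
  refine integral_congr_ae ?_
  filter_upwards [hγ.proper {x} η] with σ hσ
  rw [siteAvg_congr_of_eq_off hγ hC x hgm (σ := σ) (η := η) fun z hz => hσ z (by simpa using hz)]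

/-- **The tilt defect** (the heart of Föllmer's Theorem (2.13)): for a Gibbs measure `μ`, bounded measurable `g`, `f` with coordinatewise
Lipschitz bounds `δ_g`, `δ_f`, and any site `x`,
`|μ(g · γ_x f) − μ(g f)| ≤ (δ_g(x) R)(δ_f(x) R)`.  Proof: `μ(g γ_x f) − μ(g f) = μ((g − γ_x g)(γ_x f − f)) + [μ(γ_x g · γ_x f) − μ(γ_x g · f)]`,
the bracket vanishes by the DLR equation at `x` and the product rule, and both factors are one-site oscillations. [cite: Follmer1988, Ch. I Theorem (2.13)] -/
theorem abs_integral_mul_siteAvg_sub_le [DecidableEq V] (hγ : IsSpecification γ) (hC : IsKRContraction γ r nbr C) {R : ℝ}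
    (hrR : ∀ a b, r a b ≤ R) {μ : Measure (V → S)} (hμ : IsGibbsMeasure γ μ) (x : V)
    {g : (V → S) → ℝ} (hgm : Measurable g) {Mg : ℝ} (hMg : ∀ σ, |g σ| ≤ Mg) {δg : V → ℝ} (hδg : IsLipBound r g δg)
    {f : (V → S) → ℝ} (hfm : Measurable f) {Mf : ℝ} (hMf : ∀ σ, |f σ| ≤ Mf) {δf : V → ℝ} (hδf : IsLipBound r f δf) :
    |(∫ σ, g σ * siteAvg γ x f σ ∂μ) - ∫ σ, g σ * f σ ∂μ| ≤ δg x * R * (δf x * R) := by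
  haveI := hμ.isProbabilityMeasure
  set A := siteAvg γ x g with hA
  set B := siteAvg γ x f with hB
  have hAm : Measurable A := measurable_siteAvg hγ x hgm
  have hBm : Measurable B := measurable_siteAvg hγ x hfm
  have hAb : ∀ σ, |A σ| ≤ Mg := abs_siteAvg_le hγ x hMg
  have hBb : ∀ σ, |B σ| ≤ Mf := abs_siteAvg_le hγ x hMf
  -- integrability of the bounded products
  have hprod : ∀ {u v : (V → S) → ℝ}, Measurable u → Measurable v → ∀ {Mu Mv : ℝ}, (∀ σ, |u σ| ≤ Mu) → (∀ σ, |v σ| ≤ Mv) →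
      Integrable (fun σ => u σ * v σ) μ := by
    intro u v hu hv Mu Mv hMu hMv
    refine Integrable.of_bound (hu.mul hv).aestronglyMeasurable (Mu * Mv) (ae_of_all _ fun σ => ?_)
    rw [Real.norm_eq_abs, abs_mul]
    exact mul_le_mul (hMu σ) (hMv σ) (abs_nonneg _) ((abs_nonneg _).trans (hMu σ))
  have hgB := hprod hgm hBm hMg hBb
  have hgf := hprod hgm hfm hMg hMf
  have hAB := hprod hAm hBm hAb hBb
  have hAf := hprod hAm hfm hAb hMf
  -- DLR at `x` for `γ_x g · f`, and the product rule: `μ(γ_x g · f) = μ(γ_x g · γ_x f)`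
  have hDLR : ∫ σ, A σ * f σ ∂μ = ∫ σ, A σ * B σ ∂μ := by
    rw [← hμ.integral_integral_eq hγ {x} hAf]
    refine integral_congr_ae (ae_of_all _ fun η => ?_)
    exact siteAvg_siteAvg_mul hγ hC x hgm f η
  -- the algebraic split
  have hsplit : (∫ σ, g σ * B σ ∂μ) - ∫ σ, g σ * f σ ∂μ = ∫ σ, (g σ - A σ) * (B σ - f σ) ∂μ := by
    have e : ∀ σ, (g σ - A σ) * (B σ - f σ) = (g σ * B σ - g σ * f σ) - (A σ * B σ - A σ * f σ) := fun σ => by ring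
    simp_rw [e]
    have i1 : Integrable (fun σ => g σ * B σ - g σ * f σ) μ := hgB.sub hgf
    have i2 : Integrable (fun σ => A σ * B σ - A σ * f σ) μ := hAB.sub hAf
    rw [integral_sub i1 i2, integral_sub hgB hgf, integral_sub hAB hAf, hDLR, sub_self, sub_zero]
  rw [hsplit]
  have hpt : ∀ σ, ‖(g σ - A σ) * (B σ - f σ)‖ ≤ δg x * R * (δf x * R) := fun σ => by
    rw [Real.norm_eq_abs, abs_mul]
    refine mul_le_mul (abs_sub_siteAvg_le hγ hrR x hgm hMg hδg σ) ?_ (abs_nonneg _)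
      ((abs_nonneg _).trans (abs_sub_siteAvg_le hγ hrR x hgm hMg hδg σ))
    rw [abs_sub_comm]; exact abs_sub_siteAvg_le hγ hrR x hfm hMf hδf σ
  have h := norm_integral_le_of_norm_le_const (μ := μ) (ae_of_all _ hpt)
  simpa using h

/-! ### The pairwise covariance estimate -/

/-- **FÖLLMER'S PAIRWISE COVARIANCE ESTIMATE, Vasserstein form, with column supersolutions** (Föllmer 1988, Ch. I, Thm. (2.13) with
Remark (2.17); Künsch 1982, Thm. 2.1).  Let `γ` satisfy Dobrushin's condition in the Vasserstein form for a weight `0 ≤ r ≤ R` with rows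
`Σ_{z ∈ nbr x} C x z ≤ c < 1`, `μ` a Gibbs measure, `f, g` bounded measurable local observables with dependence sets `Δ_f, Δ_g` and
coordinatewise Lipschitz bounds `δ_f, δ_g`, and `u(·, y) ≥ 0` (`y ∈ Δ_g`) COLUMN SUPERSOLUTIONS: `1_{x = y} + Σ_{z ∈ nbr x} C(x,z) u(z,y) ≤ u(x,y)`
for every `x` (so `u(·,y) ≥ D(·,y)`, `D = Σₙ Cⁿ`).  Then `|cov_μ(f,g)| ≤ R² Σ_{x ∈ Δ_f} Σ_{y ∈ Δ_g} δ_f(x) u(x,y) δ_g(y)`.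
[cite: Follmer1988, Ch. I Theorem (2.13)] -/
theorem abs_covariance_le_pairwise [DecidableEq V] (hγ : IsSpecification γ) (hC : IsKRContraction γ r nbr C) {R : ℝ}
    (hr0 : ∀ a b, 0 ≤ r a b) (hrR : ∀ a b, r a b ≤ R) (hR : 0 ≤ R) {c : ℝ} (hc0 : 0 ≤ c) (hc1 : c < 1)
    (hrow : ∀ x, ∑ y ∈ nbr x, C x y ≤ c) {μ : Measure (V → S)} (hμ : IsGibbsMeasure γ μ) {f g : (V → S) → ℝ}
    (hfm : Measurable f) {Δf : Finset V} (hfdep : DependsOn f (↑Δf : Set V)) {Mf : ℝ} (hMf : ∀ σ, |f σ| ≤ Mf)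
    {δf : V → ℝ} (hδf : IsLipBound r f δf) (hgm : Measurable g) {Δg : Finset V} (hgdep : DependsOn g (↑Δg : Set V))
    {Mg : ℝ} (hMg : ∀ σ, |g σ| ≤ Mg) {δg : V → ℝ} (hδg : IsLipBound r g δg) {u : V → V → ℝ} (hu0 : ∀ x y, 0 ≤ u x y)
    (hu : ∀ y ∈ Δg, ∀ x, (if x = y then (1 : ℝ) else 0) + ∑ z ∈ nbr x, C x z * u z y ≤ u x y) :
    |cov[f, g; μ]| ≤ R ^ 2 * ∑ x ∈ Δf, ∑ y ∈ Δg, δf x * u x y * δg y := by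
  haveI := hμ.isProbabilityMeasure
  obtain ⟨τ₀, -⟩ := nonempty_of_measure_ne_zero (μ := μ) (s := Set.univ) (by simp)
  -- the shifted density `g̃ ∈ [0, 2 S_g]`
  set Sg : ℝ := R * ∑ y ∈ Δg, δg y with hSg
  have hSg0 : 0 ≤ Sg := mul_nonneg hR (Finset.sum_nonneg fun y _ => hδg.nonneg y)
  set gt : (V → S) → ℝ := fun σ => g σ + (Sg - g τ₀) with hgt
  have hosc : ∀ σ, |g σ - g τ₀| ≤ Sg := fun σ => abs_sub_le_mul_sum_of_dependsOn hrR hgdep hδg σ τ₀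
  have hgt0 : ∀ σ, 0 ≤ gt σ := fun σ => by have := (abs_le.1 (hosc σ)).1; simp only [hgt]; linarith
  have hgtB : ∀ σ, gt σ ≤ 2 * Sg := fun σ => by have := (abs_le.1 (hosc σ)).2; simp only [hgt]; linarith
  have hgtm : Measurable gt := hgm.add_const _
  have hgtdep : DependsOn gt (↑Δg : Set V) := fun σ τ h => by simp only [hgt]; rw [hgdep h]
  have hgtabs : ∀ σ, |gt σ| ≤ 2 * Sg := fun σ => by rw [abs_of_nonneg (hgt0 σ)]; exact hgtB σ
  have hgtlip : IsLipBound r gt δg := ⟨hδg.nonneg, fun y σ τ h => by simp only [hgt, add_sub_add_right_eq_sub]; exact hδg.le y σ τ h⟩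
  have hgi : Integrable g μ := integrable_of_abs_le' hgm hMg
  have hgti : Integrable gt μ := integrable_of_abs_le' hgtm hgtabs
  -- the restricted Lipschitz vectors
  have hδg' := hgtlip.restrict hgtdep
  have hδf' := hδf.restrict hfdep
  -- the right-hand side is nonnegative
  have hRHS : 0 ≤ R ^ 2 * ∑ x ∈ Δf, ∑ y ∈ Δg, δf x * u x y * δg y := by
    refine mul_nonneg (pow_nonneg hR 2) (Finset.sum_nonneg fun x _ => Finset.sum_nonneg fun y _ => ?_)
    exact mul_nonneg (mul_nonneg (hδf.nonneg x) (hu0 x y)) (hδg.nonneg y)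
  -- `cov(f, g) = μ(f g̃) - μ(f) μ(g̃)`
  have hcov : cov[f, g; μ] = ∫ σ, f σ * gt σ ∂μ - (∫ σ, f σ ∂μ) * ∫ σ, gt σ ∂μ := by
    have h1 : cov[f, g; μ] = cov[f, gt; μ] := by rw [hgt, covariance_add_const_right hgi]
    rw [h1, covariance_eq_sub]
    · rfl
    · exact memLp_of_bounded (a := -Mf) (b := Mf) (ae_of_all _ fun σ => abs_le.1 (hMf σ)) hfm.aestronglyMeasurable 2
    · exact memLp_of_bounded (a := -(2 * Sg)) (b := 2 * Sg) (ae_of_all _ fun σ => abs_le.1 (hgtabs σ))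
        hgtm.aestronglyMeasurable 2
  by_cases hz : ∫ σ, gt σ ∂μ = 0
  · have hae : gt =ᵐ[μ] 0 := (integral_eq_zero_iff_of_nonneg (fun σ => hgt0 σ) hgti).1 hz
    have hfg : ∫ σ, f σ * gt σ ∂μ = 0 := by
      rw [← integral_zero (α := V → S) (μ := μ) (G := ℝ)]
      refine integral_congr_ae ?_
      filter_upwards [hae] with σ hσ
      simp [hσ]
    rw [hcov, hfg, hz, mul_zero, sub_zero, abs_zero]
    exact hRHS
  have hpos : 0 < ∫ σ, gt σ ∂μ := lt_of_le_of_ne (integral_nonneg hgt0) (Ne.symm hz)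
  -- the dusting data (all sites usable), the Gibbs state and the tilt state
  let D := krDustingData hγ hC hr0 hrR hR (Set.univ : Set V)
  have h₁ : D.IsInvariantState fun φ => ∫ σ, φ σ ∂μ := isInvariantState_integral_of_isGibbsMeasure hγ hC hr0 hrR hR _ hμ
  set E₂ : ((V → S) → ℝ) → ℝ := fun φ => (∫ σ, gt σ * φ σ ∂μ) / ∫ σ, gt σ ∂μ with hE₂
  have hgfi : ∀ {φ : (V → S) → ℝ}, Measurable φ → ∀ {M : ℝ}, (∀ σ, |φ σ| ≤ M) → Integrable (fun σ => gt σ * φ σ) μ :=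
    fun hφm M hM => hgti.mul_bdd hφm.aestronglyMeasurable (ae_of_all _ fun σ => by rw [Real.norm_eq_abs]; exact hM σ)
  have h₂ : D.IsState E₂ := by
    refine ⟨fun {φ Δ M} hφ hM => ?_, fun {φ Δ m} hφ hm => ?_⟩
    · obtain ⟨hφm, -, B', hB'⟩ := hφ
      simp only [hE₂]; rw [div_le_iff₀ hpos]
      calc ∫ σ, gt σ * φ σ ∂μ ≤ ∫ σ, gt σ * M ∂μ :=
            integral_mono (hgfi hφm hB') (hgti.mul_const M) fun σ => mul_le_mul_of_nonneg_left (hM σ) (hgt0 σ)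
        _ = M * ∫ σ, gt σ ∂μ := by rw [integral_mul_const, mul_comm]
    · obtain ⟨hφm, -, B', hB'⟩ := hφ
      simp only [hE₂]; rw [le_div_iff₀ hpos]
      calc m * ∫ σ, gt σ ∂μ = ∫ σ, gt σ * m ∂μ := by rw [integral_mul_const, mul_comm]
        _ ≤ ∫ σ, gt σ * φ σ ∂μ :=
            integral_mono (hgti.mul_const m) (hgfi hφm hB') fun σ => mul_le_mul_of_nonneg_left (hm σ) (hgt0 σ)
  -- the defect of the tilt: `b x = R² δ̃_g(x) / μ(g̃)`
  set b : V → ℝ := fun x => R ^ 2 * (if x ∈ Δg then δg x else 0) / ∫ σ, gt σ ∂μ with hb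
  have hb0 : ∀ x, 0 ≤ b x := fun x => by
    have h : 0 ≤ (if x ∈ Δg then δg x else 0) := by
      split_ifs
      · exact hδg.nonneg x
      · exact le_rfl
    exact div_nonneg (mul_nonneg (pow_nonneg hR 2) h) hpos.le
  have hdef : D.HasDefect E₂ b := by
    intro φ Δ δ x _ hφ hδ
    obtain ⟨hφm, -, M, hM⟩ := hφ
    have key := abs_integral_mul_siteAvg_sub_le hγ hC hrR hμ x hgtm hgtabs hδg' hφm hM hδ
    change |(∫ σ, gt σ * siteAvg γ x φ σ ∂μ) / (∫ σ, gt σ ∂μ) - (∫ σ, gt σ * φ σ ∂μ) / ∫ σ, gt σ ∂μ| ≤ b x * δ x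
    rw [← sub_div, abs_div, abs_of_pos hpos, div_le_iff₀ hpos]
    refine key.trans (le_of_eq ?_)
    simp only [hb]
    field_simp
  -- the supersolution `d x = (R²/μ(g̃)) Σ_y δ̃_g(y) u(x,y)`
  set d : V → ℝ := fun x => R ^ 2 / (∫ σ, gt σ ∂μ) * ∑ y ∈ Δg, δg y * u x y with hd
  have hd0 : ∀ x, 0 ≤ d x := fun x =>
    mul_nonneg (div_nonneg (pow_nonneg hR 2) hpos.le) (Finset.sum_nonneg fun y _ => mul_nonneg (hδg.nonneg y) (hu0 x y))
  have hrowD : ∀ x, ∑ y ∈ D.nbr x, D.C x y ≤ c := fun x => (sum_krDustingData_C hγ hC hr0 hrR hR _ x).le.trans (hrow x)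
  have hdD : ∀ x, b x + D.rowC d x ≤ d x := by
    intro x
    have e : D.rowC d x = ∑ z ∈ nbr x, C x z * d z := by
      change ∑ z ∈ nbr x, (if z ∈ nbr x then C x z else 0) * d z = _
      exact Finset.sum_congr rfl fun z hz => by rw [if_pos hz]
    rw [e]
    -- `b x + Σ_z C x z d z = (R²/μg̃) Σ_y δg y (1_{x=y} + Σ_z C x z u z y) ≤ (R²/μg̃) Σ_y δg y u x y`
    have hind : (if x ∈ Δg then δg x else 0) = ∑ y ∈ Δg, δg y * (if x = y then (1 : ℝ) else 0) := by
      have h' : ∀ y ∈ Δg, δg y * (if x = y then (1 : ℝ) else 0) = if x = y then δg y else 0 := fun y _ => by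
        split_ifs <;> simp
      rw [Finset.sum_congr rfl h', Finset.sum_ite_eq]
    have hK0 : 0 ≤ R ^ 2 / ∫ σ, gt σ ∂μ := div_nonneg (pow_nonneg hR 2) hpos.le
    have hb' : b x = R ^ 2 / (∫ σ, gt σ ∂μ) * ∑ y ∈ Δg, δg y * (if x = y then (1 : ℝ) else 0) := by
      simp only [hb]; rw [hind, mul_div_right_comm]
    have hCd : ∑ z ∈ nbr x, C x z * d z = R ^ 2 / (∫ σ, gt σ ∂μ) * ∑ y ∈ Δg, δg y * ∑ z ∈ nbr x, C x z * u z y := by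
      simp only [hd]
      calc ∑ z ∈ nbr x, C x z * (R ^ 2 / (∫ σ, gt σ ∂μ) * ∑ y ∈ Δg, δg y * u z y)
          = R ^ 2 / (∫ σ, gt σ ∂μ) * ∑ z ∈ nbr x, ∑ y ∈ Δg, C x z * (δg y * u z y) := by
            rw [Finset.mul_sum]
            refine Finset.sum_congr rfl fun z _ => ?_
            rw [Finset.mul_sum, Finset.mul_sum, Finset.mul_sum]
            exact Finset.sum_congr rfl fun y _ => by ring
        _ = R ^ 2 / (∫ σ, gt σ ∂μ) * ∑ y ∈ Δg, δg y * ∑ z ∈ nbr x, C x z * u z y := by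
            rw [Finset.sum_comm]
            congr 1
            refine Finset.sum_congr rfl fun y _ => ?_
            rw [Finset.mul_sum]
            exact Finset.sum_congr rfl fun z _ => by ring
    rw [hb', hCd, ← mul_add, ← Finset.sum_add_distrib]
    show _ ≤ R ^ 2 / (∫ σ, gt σ ∂μ) * ∑ y ∈ Δg, δg y * u x y
    refine mul_le_mul_of_nonneg_left (Finset.sum_le_sum fun y hy => ?_) hK0
    rw [← mul_add]
    exact mul_le_mul_of_nonneg_left (hu y hy x) (hδg.nonneg y)
  have key := DustingData.abs_sub_le_sum_of_superSolution h₁ h₂ hdef hb0 hc0 hc1 (fun x => Set.mem_univ x) hrowD hd0 hdD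
    (f := f) (Δ := Δf) ⟨hfm, hfdep, Mf, hMf⟩ hδf' (fun y hy => if_neg hy)
  -- unfold: `|μ f − μ(g̃ f)/μ(g̃)| ≤ Σ_{x ∈ Δf} d x δf x`
  have hsum : ∑ y ∈ Δf, d y * (if y ∈ Δf then δf y else 0) = ∑ y ∈ Δf, d y * δf y :=
    Finset.sum_congr rfl fun y hy => by rw [if_pos hy]
  have key' : |(∫ σ, f σ ∂μ) - (∫ σ, gt σ * f σ ∂μ) / ∫ σ, gt σ ∂μ| ≤ ∑ y ∈ Δf, d y * δf y := by rw [← hsum]; exact key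
  -- `cov = μ(g̃) · (μ_{g̃}(f) - μ(f))`
  have hfgt : ∫ σ, f σ * gt σ ∂μ = ∫ σ, gt σ * f σ ∂μ := integral_congr_ae (ae_of_all _ fun σ => mul_comm _ _)
  have hident : cov[f, g; μ] = (∫ σ, gt σ ∂μ) * ((∫ σ, gt σ * f σ ∂μ) / ∫ σ, gt σ ∂μ - ∫ σ, f σ ∂μ) := by
    rw [hcov, hfgt, mul_sub, mul_div_cancel₀ _ hz]; ring
  rw [hident, abs_mul, abs_of_pos hpos, abs_sub_comm]
  calc (∫ σ, gt σ ∂μ) * |(∫ σ, f σ ∂μ) - (∫ σ, gt σ * f σ ∂μ) / ∫ σ, gt σ ∂μ|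
      ≤ (∫ σ, gt σ ∂μ) * ∑ y ∈ Δf, d y * δf y := mul_le_mul_of_nonneg_left key' hpos.le
    _ = R ^ 2 * ∑ x ∈ Δf, ∑ y ∈ Δg, δf x * u x y * δg y := by
        simp only [hd]
        rw [Finset.mul_sum, Finset.mul_sum]
        refine Finset.sum_congr rfl fun x _ => ?_
        rw [Finset.mul_sum, Finset.mul_sum, Finset.sum_mul, Finset.mul_sum]
        refine Finset.sum_congr rfl fun y _ => ?_
        field_simp

/-- **Lyapunov form**: strict supersolutions with margin.  If `p(·,y) ≥ 0`, `p(y,y) > 0` and `Σ_{z ∈ nbr x} C(x,z) p(z,y) ≤ s·p(x,y)` for all `x`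
(`y ∈ Δ_g`, `s < 1`), then `|cov_μ(f,g)| ≤ (R²/(1−s)) Σ_{x ∈ Δ_f} Σ_{y ∈ Δ_g} δ_f(x) (p(x,y)/p(y,y)) δ_g(y)`. [cite: Follmer1988, Ch. I Theorem (2.13)] -/
theorem abs_covariance_le_pairwise_of_strict [DecidableEq V] (hγ : IsSpecification γ) (hC : IsKRContraction γ r nbr C) {R : ℝ}
    (hr0 : ∀ a b, 0 ≤ r a b) (hrR : ∀ a b, r a b ≤ R) (hR : 0 ≤ R) {c : ℝ} (hc0 : 0 ≤ c) (hc1 : c < 1)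
    (hrow : ∀ x, ∑ y ∈ nbr x, C x y ≤ c) {μ : Measure (V → S)} (hμ : IsGibbsMeasure γ μ) {f g : (V → S) → ℝ}
    (hfm : Measurable f) {Δf : Finset V} (hfdep : DependsOn f (↑Δf : Set V)) {Mf : ℝ} (hMf : ∀ σ, |f σ| ≤ Mf)
    {δf : V → ℝ} (hδf : IsLipBound r f δf) (hgm : Measurable g) {Δg : Finset V} (hgdep : DependsOn g (↑Δg : Set V))
    {Mg : ℝ} (hMg : ∀ σ, |g σ| ≤ Mg) {δg : V → ℝ} (hδg : IsLipBound r g δg) {s : ℝ} (hs1 : s < 1)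
    {p : V → V → ℝ} (hp0 : ∀ x y, 0 ≤ p x y) (hpy : ∀ y ∈ Δg, 0 < p y y)
    (hp : ∀ y ∈ Δg, ∀ x, ∑ z ∈ nbr x, C x z * p z y ≤ s * p x y) :
    |cov[f, g; μ]| ≤ R ^ 2 / (1 - s) * ∑ x ∈ Δf, ∑ y ∈ Δg, δf x * (p x y / p y y) * δg y := by
  have h1s : 0 < 1 - s := by linarith
  -- `u(x,y) = p(x,y) / ((1-s) p(y,y))` off `Δg` we may take anything nonnegative: use the same formula with `p y y` replaced by `1` when `y ∉ Δg`
  set u : V → V → ℝ := fun x y => p x y / ((1 - s) * (if y ∈ Δg then p y y else 1)) with hu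
  have hden : ∀ y, 0 < (1 - s) * (if y ∈ Δg then p y y else 1) := fun y => by
    split_ifs with hy
    · exact mul_pos h1s (hpy y hy)
    · rw [mul_one]; exact h1s
  have hu0 : ∀ x y, 0 ≤ u x y := fun x y => div_nonneg (hp0 x y) (hden y).le
  have hcol : ∀ y ∈ Δg, ∀ x, (if x = y then (1 : ℝ) else 0) + ∑ z ∈ nbr x, C x z * u z y ≤ u x y := by
    intro y hy x
    simp only [hu, if_pos hy]
    have hq : 0 < (1 - s) * p y y := mul_pos h1s (hpy y hy)
    have hS : ∑ z ∈ nbr x, C x z * (p z y / ((1 - s) * p y y)) = (∑ z ∈ nbr x, C x z * p z y) / ((1 - s) * p y y) := by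
      rw [Finset.sum_div]
      exact Finset.sum_congr rfl fun z _ => by rw [mul_div_assoc]
    rw [hS, ← le_sub_iff_add_le, ← sub_div, le_div_iff₀ hq]
    have hpx := hp y hy x
    have hpxy := hp0 x y
    split_ifs with hxy
    · subst hxy; linarith
    · rw [zero_mul]; nlinarith
  refine (abs_covariance_le_pairwise hγ hC hr0 hrR hR hc0 hc1 hrow hμ hfm hfdep hMf hδf hgm hgdep hMg hδg hu0 hcol).trans
    (le_of_eq ?_)
  have e : ∀ x ∈ Δf, ∀ y ∈ Δg, δf x * u x y * δg y = (1 / (1 - s)) * (δf x * (p x y / p y y) * δg y) := by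
    intro x _ y hy
    have hpy' := (hpy y hy).ne'
    simp only [hu, if_pos hy]
    field_simp
  rw [Finset.sum_congr rfl fun x hx => Finset.sum_congr rfl fun y hy => e x hx y hy]
  simp_rw [← Finset.mul_sum]
  ring

/-- **THE CURRENCY SHAPE.**  If in addition `p(x,y)/p(y,y) ≤ B · t` for all `x ∈ Δ_f`, `y ∈ Δ_g` (e.g. `t = θ^{2n−1}` for supports at
axial distance `≥ n`, a different axis for every pair), then `|cov_μ(f,g)| ≤ (R² B/(1−s)) (Σ δ_g)(Σ δ_f) · t`. [cite: Follmer1988, Ch. I Theorem (2.13)] -/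
theorem abs_covariance_le_of_pair_profile [DecidableEq V] (hγ : IsSpecification γ) (hC : IsKRContraction γ r nbr C) {R : ℝ}
    (hr0 : ∀ a b, 0 ≤ r a b) (hrR : ∀ a b, r a b ≤ R) (hR : 0 ≤ R) {c : ℝ} (hc0 : 0 ≤ c) (hc1 : c < 1)
    (hrow : ∀ x, ∑ y ∈ nbr x, C x y ≤ c) {μ : Measure (V → S)} (hμ : IsGibbsMeasure γ μ) {f g : (V → S) → ℝ}
    (hfm : Measurable f) {Δf : Finset V} (hfdep : DependsOn f (↑Δf : Set V)) {Mf : ℝ} (hMf : ∀ σ, |f σ| ≤ Mf)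
    {δf : V → ℝ} (hδf : IsLipBound r f δf) (hgm : Measurable g) {Δg : Finset V} (hgdep : DependsOn g (↑Δg : Set V))
    {Mg : ℝ} (hMg : ∀ σ, |g σ| ≤ Mg) {δg : V → ℝ} (hδg : IsLipBound r g δg) {s : ℝ} (hs1 : s < 1)
    {p : V → V → ℝ} (hp0 : ∀ x y, 0 ≤ p x y) (hpy : ∀ y ∈ Δg, 0 < p y y)
    (hp : ∀ y ∈ Δg, ∀ x, ∑ z ∈ nbr x, C x z * p z y ≤ s * p x y) {B t : ℝ}
    (hpt : ∀ x ∈ Δf, ∀ y ∈ Δg, p x y / p y y ≤ B * t) :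
    |cov[f, g; μ]| ≤ R ^ 2 * B / (1 - s) * (∑ y ∈ Δg, δg y) * (∑ x ∈ Δf, δf x) * t := by
  have h1s : 0 < 1 - s := by linarith
  refine (abs_covariance_le_pairwise_of_strict hγ hC hr0 hrR hR hc0 hc1 hrow hμ hfm hfdep hMf hδf hgm hgdep hMg hδg hs1
    hp0 hpy hp).trans ?_
  have hsum : ∑ x ∈ Δf, ∑ y ∈ Δg, δf x * (p x y / p y y) * δg y ≤ ∑ x ∈ Δf, ∑ y ∈ Δg, δf x * (B * t) * δg y :=
    Finset.sum_le_sum fun x hx => Finset.sum_le_sum fun y hy =>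
      mul_le_mul_of_nonneg_right (mul_le_mul_of_nonneg_left (hpt x hx y hy) (hδf.nonneg x)) (hδg.nonneg y)
  calc R ^ 2 / (1 - s) * ∑ x ∈ Δf, ∑ y ∈ Δg, δf x * (p x y / p y y) * δg y
      ≤ R ^ 2 / (1 - s) * ∑ x ∈ Δf, ∑ y ∈ Δg, δf x * (B * t) * δg y :=
        mul_le_mul_of_nonneg_left hsum (div_nonneg (pow_nonneg hR 2) h1s.le)
    _ = R ^ 2 * B / (1 - s) * (∑ y ∈ Δg, δg y) * (∑ x ∈ Δf, δf x) * t := by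
        have e : ∑ x ∈ Δf, ∑ y ∈ Δg, δf x * (B * t) * δg y = B * t * ((∑ x ∈ Δf, δf x) * ∑ y ∈ Δg, δg y) := by
          rw [Finset.sum_mul, Finset.mul_sum]
          refine Finset.sum_congr rfl fun x _ => ?_
          rw [Finset.mul_sum, Finset.mul_sum]
          exact Finset.sum_congr rfl fun y _ => by ring
        rw [e]
        field_simp

end Summit.Ventures.YMGap.RobustBall.DobrushinPairwise

end
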